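import Literature.Topology.FourManifolds.TautFoliationsCollarRadius
import Literature.Topology.FourManifolds.TautFoliationsTameMono
import HarnessLib

/-!
# Piecewise constant/strictly monotone functions are tame

Sibling of `TautFoliationsCollarRadius.lean` and `TautFoliationsTameMono.lean`. A function on
`[0, len]` which is constant on `[0, u⋆]` and strictly monotone on `[u⋆, len]`, or strictly
monotone on `[0, u⋆]` and constant on `[u⋆, len]` (`PieceShape`, either direction of
monotonicity), and continuous, is tame; the shape is preserved by post-composition with affine
maps. With `CollarRadius` this shows that the levels of the collar disc along the outer-collar
grid edges are tame functions of the edge parameter.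

* `PieceShape` (**definition**), `ConstMonoShape.pieceShape`, `PieceShape.affine_comp`,
  `PieceShape.isTameOn` (**proved**);
* `maxAbs_pieceShape`, `dist_horizontal_pieceShape`, `dist_vertical_pieceShape` (**proved**): the
  shape of the distance along segments of length `≤ 2R₀` (covers all grid edges in the collar).

All statements are [folklore].
-/

noncomputable section

open Set Function Metric

namespace Literature.Topology.FourManifolds

namespace CollarRadius

open TameFunction

/-- **Piece shape**: constant then strictly monotone (either direction), or strictly monotone
then constant, on `[0, len]`. [folklore] -/
def PieceShape (f : ℝ → ℝ) (len : ℝ) : Prop :=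
  ∃ u ∈ Icc 0 len,
    ((∀ v ∈ Icc 0 u, f v = f 0) ∧ (StrictMonoOn f (Icc u len) ∨ StrictAntiOn f (Icc u len))) ∨
    ((StrictMonoOn f (Icc 0 u) ∨ StrictAntiOn f (Icc 0 u)) ∧ ∀ v ∈ Icc u len, f v = f len)

/-- A constant/monotone shape is a piece shape. [folklore] -/
theorem ConstMonoShape.pieceShape {f : ℝ → ℝ} {len : ℝ} (h : ConstMonoShape f len) : PieceShape f len := by
  obtain ⟨u, hu, h⟩ := h
  rcases h with ⟨h1, h2⟩ | ⟨h1, h2⟩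
  · exact ⟨u, hu, Or.inl ⟨h1, Or.inl h2⟩⟩
  · exact ⟨u, hu, Or.inr ⟨Or.inr h1, h2⟩⟩

/-- **Affine post-composition preserves the piece shape** (nonzero slope). [folklore] -/
theorem PieceShape.affine_comp {f : ℝ → ℝ} {len : ℝ} (h : PieceShape f len) (A : ℝ) {Bm : ℝ} (hB : Bm ≠ 0) :
    PieceShape (fun v ↦ A + Bm * f v) len := by
  have hmono : ∀ {s : Set ℝ}, (StrictMonoOn f s ∨ StrictAntiOn f s) →
      (StrictMonoOn (fun v ↦ A + Bm * f v) s ∨ StrictAntiOn (fun v ↦ A + Bm * f v) s) := by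
    intro s hs
    rcases lt_or_gt_of_ne hB with hB | hB
    · rcases hs with hs | hs
      · exact Or.inr fun a ha b hb hab ↦ by have := hs ha hb hab; simp only; nlinarith
      · exact Or.inl fun a ha b hb hab ↦ by have := hs ha hb hab; simp only; nlinarith
    · rcases hs with hs | hs
      · exact Or.inl fun a ha b hb hab ↦ by have := hs ha hb hab; simp only; nlinarith
      · exact Or.inr fun a ha b hb hab ↦ by have := hs ha hb hab; simp only; nlinarith
  obtain ⟨u, hu, h⟩ := h
  rcases h with ⟨h1, h2⟩ | ⟨h1, h2⟩
  · exact ⟨u, hu, Or.inl ⟨fun v hv ↦ by simp only; rw [h1 v hv], hmono h2⟩⟩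
  · exact ⟨u, hu, Or.inr ⟨hmono h1, fun v hv ↦ by simp only; rw [h2 v hv]⟩⟩

/-- **A continuous function with a piece shape is tame.** [folklore] -/
theorem PieceShape.isTameOn {f : ℝ → ℝ} {len : ℝ} (h : PieceShape f len) (hc : ContinuousOn f (Icc 0 len)) :
    IsTameOn f 0 len := by
  obtain ⟨u, hu, h⟩ := h
  -- one-sided pieces as tameness witnesses
  have right_of_piece : ∀ {a b x : ℝ}, x ∈ Ico a b →
      ((∀ v ∈ Icc a b, f v = f a) ∨ StrictMonoOn f (Icc a b) ∨ StrictAntiOn f (Icc a b)) → IsTameRight f x := by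
    intro a b x hx hp
    have hsub : Icc x (x + (b - x)) ⊆ Icc a b := by rw [add_sub_cancel]; exact Icc_subset_Icc_left hx.1
    refine ⟨b - x, by linarith [hx.2], ?_⟩
    rcases hp with hp | hp | hp
    · exact Or.inr (Or.inr fun y hy ↦ by rw [hp y (hsub hy), hp x ⟨hx.1, hx.2.le⟩])
    · exact Or.inl (hp.mono hsub)
    · exact Or.inr (Or.inl (hp.mono hsub))
  have left_of_piece : ∀ {a b x : ℝ}, x ∈ Ioc a b →
      ((∀ v ∈ Icc a b, f v = f a) ∨ StrictMonoOn f (Icc a b) ∨ StrictAntiOn f (Icc a b)) → IsTameLeft f x := by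
    intro a b x hx hp
    have hsub : Icc (x - (x - a)) x ⊆ Icc a b := by rw [sub_sub_cancel]; exact Icc_subset_Icc_right hx.2
    refine ⟨x - a, by linarith [hx.1], ?_⟩
    rcases hp with hp | hp | hp
    · exact Or.inr (Or.inr fun y hy ↦ by rw [hp y (hsub hy), hp x ⟨hx.1.le, hx.2⟩])
    · exact Or.inl (hp.mono hsub)
    · exact Or.inr (Or.inl (hp.mono hsub))
  -- the two pieces, as properties of the form used above
  have hpieces : ((∀ v ∈ Icc 0 u, f v = f 0) ∨ StrictMonoOn f (Icc 0 u) ∨ StrictAntiOn f (Icc 0 u)) ∧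
      ((∀ v ∈ Icc u len, f v = f u) ∨ StrictMonoOn f (Icc u len) ∨ StrictAntiOn f (Icc u len)) := by
    rcases h with ⟨h1, h2⟩ | ⟨h1, h2⟩
    · exact ⟨Or.inl h1, Or.inr h2⟩
    · refine ⟨Or.inr h1, Or.inl fun v hv ↦ ?_⟩
      rw [h2 v hv, h2 u ⟨le_rfl, hu.2⟩]
  refine ⟨hc, fun x hx ↦ ?_, fun x hx ↦ ?_⟩
  · -- right tameness
    rcases lt_or_ge x u with hxu | hxu
    · exact right_of_piece ⟨hx.1, hxu⟩ hpieces.1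
    · exact right_of_piece ⟨hxu, hx.2⟩ hpieces.2
  · -- left tameness
    rcases le_or_gt x u with hxu | hxu
    · exact left_of_piece ⟨hx.1, hxu⟩ hpieces.1
    · exact left_of_piece ⟨hxu, hx.2⟩ hpieces.2

/-- A function constant on `[0, len]` has a piece shape (degenerate). [folklore] -/
theorem pieceShape_of_forall_eq {f : ℝ → ℝ} {len : ℝ} (hlen : 0 ≤ len) (h : ∀ v ∈ Icc 0 len, f v = f 0) :
    PieceShape f len :=
  ⟨len, ⟨hlen, le_rfl⟩, Or.inl ⟨h, Or.inl fun a ha b hb hab ↦ by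
    exfalso
    rw [le_antisymm ha.2 ha.1, le_antisymm hb.2 hb.1] at hab
    exact lt_irrefl _ hab⟩⟩

/-! ## The shape of the distance along longer segments -/

/-- **The shape of `u ↦ max |α + u| C` on `[0, len]`, `len ≤ 2 R₀`, far from the origin**
(`R₀ ≤ max |α + u| C` throughout): a piece shape. Compared with `maxAbs_shape` the length
hypothesis is relaxed to `len ≤ 2 R₀` (the sign of `α + u` cannot change while
`|α + u| ≥ R₀ > 0`, and passing from `α + u < -C` to `α + u > C` needs length `> 2C ≥ 2R₀`).
[folklore] -/
theorem maxAbs_pieceShape {α C len R₀ : ℝ} (hC : 0 ≤ C) (hlen : 0 ≤ len) (hR₀ : 0 < R₀) (hR : len ≤ 2 * R₀)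
    (hfar : ∀ u ∈ Icc 0 len, R₀ ≤ max |α + u| C) : PieceShape (fun u ↦ max |α + u| C) len := by
  by_cases hCR : C < R₀
  · -- `|α + u| ≥ R₀ > 0` throughout: constant sign
    have habs : ∀ u ∈ Icc 0 len, R₀ ≤ |α + u| := fun u hu ↦ by
      rcases le_max_iff.1 (hfar u hu) with h | h
      · exact h
      · exact absurd h (not_le.2 hCR)
    have hmax : ∀ u ∈ Icc 0 len, max |α + u| C = |α + u| := fun u hu ↦ max_eq_left (hCR.le.trans (habs u hu))
    have hsign : (∀ u ∈ Icc 0 len, R₀ ≤ α + u) ∨ (∀ u ∈ Icc 0 len, α + u ≤ -R₀) := by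
      by_cases h0 : 0 ≤ α
      · left; intro u hu
        have h := habs u hu
        rw [abs_of_nonneg (by linarith [hu.1])] at h; exact h
      · right; intro u hu
        by_contra hcon
        push Not at hcon
        -- `α < 0 < ... `: by the intermediate value theorem `α + u' = 0` for some `u' ∈ [0, u]`
        have hneg0 : α + 0 < 0 := by linarith [not_le.1 h0]
        have hposu : 0 ≤ α + u := by
          have h := habs u hu
          by_contra hlt; push Not at hlt
          rw [abs_of_neg hlt] at h; linarith
        obtain ⟨u', hu', hu'0⟩ : ∃ u' ∈ Icc 0 u, α + u' = 0 := by
          have hc : ContinuousOn (fun v ↦ α + v) (Icc 0 u) := by fun_prop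
          have := intermediate_value_Icc hu.1 hc
          exact this ⟨hneg0.le, hposu⟩
        have h := habs u' ⟨hu'.1, hu'.2.trans hu.2⟩
        rw [hu'0, abs_zero] at h
        linarith
    rcases hsign with h | h
    · refine ⟨0, ⟨le_rfl, hlen⟩, Or.inl ⟨fun v hv ↦ by rw [le_antisymm hv.2 hv.1], Or.inl fun a ha b hb hab ↦ ?_⟩⟩
      simp only
      rw [hmax a ha, hmax b hb, abs_of_nonneg (by linarith [h a ha, h b hb]), abs_of_nonneg (by linarith [h a ha, h b hb])]
      linarith
    · refine ⟨0, ⟨le_rfl, hlen⟩, Or.inl ⟨fun v hv ↦ by rw [le_antisymm hv.2 hv.1], Or.inr fun a ha b hb hab ↦ ?_⟩⟩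
      simp only
      rw [hmax a ha, hmax b hb, abs_of_nonpos (by linarith [h a ha, h b hb]), abs_of_nonpos (by linarith [h a ha, h b hb])]
      linarith [h a ha, h b hb]
  · -- `C ≥ R₀`: as in `maxAbs_shape`, the two strict sides cannot both occur (length `≤ 2R₀ ≤ 2C`)
    push Not at hCR
    have hmax_of_le : ∀ u, |α + u| ≤ C → max |α + u| C = C := fun u h ↦ max_eq_right h
    have hmax_of_ge : ∀ u, C ≤ |α + u| → max |α + u| C = |α + u| := fun u h ↦ max_eq_left h
    by_cases hpos : ∃ u ∈ Icc 0 len, C < α + u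
    · obtain ⟨u₁, hu₁, hu₁C⟩ := hpos
      have hgt : ∀ v ∈ Icc 0 len, -C < α + v := fun v hv ↦ by
        have h1 : α + u₁ - (α + v) ≤ len := by linarith [hu₁.2, hv.1]
        linarith
      set us : ℝ := max 0 (C - α) with hus
      have husle : us ≤ len := max_le hlen (by linarith [hu₁.2])
      refine ⟨us, ⟨le_max_left _ _, husle⟩, Or.inl ⟨fun v hv ↦ ?_, Or.inl fun a ha b hb hab ↦ ?_⟩⟩
      · by_cases hflat : C - α ≤ 0
        · have : us = 0 := max_eq_left hflat
          rw [this] at hv; rw [le_antisymm hv.2 hv.1]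
        · push Not at hflat
          have husC : us = C - α := max_eq_right hflat.le
          have h1 : |α + v| ≤ C := abs_le.2 ⟨by linarith [hgt v ⟨hv.1, hv.2.trans husle⟩], by rw [husC] at hv; linarith [hv.2]⟩
          have h0 : |α + 0| ≤ C := abs_le.2 ⟨by linarith [hgt 0 ⟨le_rfl, hlen⟩], by linarith⟩
          simp only
          rw [hmax_of_le v h1, hmax_of_le 0 h0]
      · simp only
        have hage : C ≤ α + a := by have := le_max_right 0 (C - α); linarith [ha.1]
        have hbge : C ≤ α + b := by have := le_max_right 0 (C - α); linarith [hb.1]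
        rw [hmax_of_ge a (hage.trans (le_abs_self _)), hmax_of_ge b (hbge.trans (le_abs_self _)),
          abs_of_nonneg (hC.trans hage), abs_of_nonneg (hC.trans hbge)]
        linarith
    · push Not at hpos
      by_cases hneg : ∃ u ∈ Icc 0 len, α + u < -C
      · obtain ⟨u₁, hu₁, hu₁C⟩ := hneg
        set us : ℝ := min len (-C - α) with hus
        have hus0 : 0 ≤ us := le_min hlen (by linarith [hu₁.1])
        refine ⟨us, ⟨hus0, min_le_left _ _⟩, Or.inr ⟨Or.inr fun a ha b hb hab ↦ ?_, fun v hv ↦ ?_⟩⟩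
        · simp only
          have hale : α + a ≤ -C := by have := min_le_right len (-C - α); linarith [ha.2]
          have hble : α + b ≤ -C := by have := min_le_right len (-C - α); linarith [hb.2]
          rw [hmax_of_ge a (by rw [abs_of_nonpos (by linarith)]; linarith),
            hmax_of_ge b (by rw [abs_of_nonpos (by linarith)]; linarith),
            abs_of_nonpos (by linarith), abs_of_nonpos (by linarith)]
          linarith
        · by_cases hflat : len ≤ -C - α
          · have : us = len := min_eq_left hflat
            rw [this] at hv; rw [le_antisymm hv.1 hv.2]
          · push Not at hflat
            have husC : us = -C - α := min_eq_right hflat.le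
            have h1 : |α + v| ≤ C := abs_le.2 ⟨by rw [husC] at hv; linarith [hv.1], hpos v ⟨hus0.trans hv.1, hv.2⟩⟩
            have h2 : |α + len| ≤ C := abs_le.2 ⟨by linarith, hpos len ⟨hlen, le_rfl⟩⟩
            simp only
            rw [hmax_of_le v h1, hmax_of_le len h2]
      · push Not at hneg
        exact pieceShape_of_forall_eq hlen fun v hv ↦ by
          show max |α + v| C = max |α + 0| C
          rw [hmax_of_le v (abs_le.2 ⟨hneg v hv, hpos v hv⟩), hmax_of_le 0 (abs_le.2 ⟨hneg 0 ⟨le_rfl, hlen⟩, hpos 0 ⟨le_rfl, hlen⟩⟩)]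

/-- **The distance to `c₀` along a horizontal segment of length `≤ 2R₀` far from `c₀`** has a
piece shape. [folklore] -/
theorem dist_horizontal_pieceShape {c₀ x₀ : ℝ × ℝ} {len R₀ : ℝ} (hlen : 0 ≤ len) (hR₀ : 0 < R₀) (hR : len ≤ 2 * R₀)
    (hfar : ∀ u ∈ Icc 0 len, R₀ ≤ dist (x₀ + ((u, 0) : ℝ × ℝ)) c₀) :
    PieceShape (fun u ↦ dist (x₀ + ((u, 0) : ℝ × ℝ)) c₀) len := by
  have heq : ∀ u, dist (x₀ + ((u, 0) : ℝ × ℝ)) c₀ = max |x₀.1 - c₀.1 + u| |x₀.2 - c₀.2| := fun u ↦ by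
    rw [Prod.dist_eq, Real.dist_eq, Real.dist_eq]
    simp only [Prod.fst_add, Prod.snd_add, add_zero]
    congr 1; ring_nf
  simp_rw [heq]
  exact maxAbs_pieceShape (abs_nonneg _) hlen hR₀ hR fun u hu ↦ by rw [← heq]; exact hfar u hu

/-- **The distance to `c₀` along a vertical segment of length `≤ 2R₀` far from `c₀`** has a
piece shape. [folklore] -/
theorem dist_vertical_pieceShape {c₀ x₀ : ℝ × ℝ} {len R₀ : ℝ} (hlen : 0 ≤ len) (hR₀ : 0 < R₀) (hR : len ≤ 2 * R₀)
    (hfar : ∀ u ∈ Icc 0 len, R₀ ≤ dist (x₀ + ((0, u) : ℝ × ℝ)) c₀) :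
    PieceShape (fun u ↦ dist (x₀ + ((0, u) : ℝ × ℝ)) c₀) len := by
  have heq : ∀ u, dist (x₀ + ((0, u) : ℝ × ℝ)) c₀ = max |x₀.2 - c₀.2 + u| |x₀.1 - c₀.1| := fun u ↦ by
    rw [Prod.dist_eq, Real.dist_eq, Real.dist_eq, max_comm]
    simp only [Prod.fst_add, Prod.snd_add, add_zero]
    congr 1; ring_nf
  simp_rw [heq]
  exact maxAbs_pieceShape (abs_nonneg _) hlen hR₀ hR fun u hu ↦ by rw [← heq]; exact hfar u hu

end CollarRadius

end Literature.Topology.FourManifolds
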